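import Mathlib.GroupTheory.Index
import Mathlib.Data.ZMod.Basic
import Literature.Algebra.EuclideanLattices.KhotBasicReduction
import HarnessLib

/-!
# Khot 2005, §5.2.2: the random sub-lattice — Lemmas 5.6, 5.7, 5.8 in counting form

Topic `Algebra/EuclideanLattices`, namespace `Literature.Algebra.EuclideanLattices.Khot`. Fifth
brick of the decomposition of `Literature.Algebra.EuclideanLattices.gapSVP_const_isNPHardRandomized`
(pqc.S17) through `Khot2005_SAT_randReducible_gapSVP` (see `KhotSVPHardness.lean`). The final
lattice of Thm. 5.1 (`Khot.finBasis`, `KhotBasicReduction.lean`) depends on a row vector `r`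
"each of whose co-ordinates is chosen randomly from the range `[0, q-1]`"; the deterministic
cores `Khot.noStructure_finBasis` / `Khot.yes_finBasis` reduce Thm. 5.1 (3) / (2) to two events
about `r`: (NO) `r` kills every annoying vector, `r·(Bx) ≢ 0 (mod q)`; (YES) some good vector
survives, `r·(Bx*) ≡ 0 (mod q)`. This file PROVES the probability estimates of these events, as
exact COUNTING statements over the uniform space `(ℤ/q)^{Rw}` (probabilities are recovered by
dividing by `q^{|Rw|}`; the machine-level sampling of `r` from coins is a later brick):

* `card_dotForm_eq_zero_mul_le` — for a vector with a nonzero integer coordinate `v`,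
  `#{r | r·a = 0} ≤ q^{|R|-1}·|v|` (the range of the form `r ↦ r·a` contains the cyclic group
  of `a i₀`, of order `q / gcd(q,|v|)`; fibres of a homomorphism have equal size,
  `card_fiber_mul_card_range`);
* `card_dotForm_eq_mul_of_one`, `card_dotForm_pair_eq_mul` — exact fibre sizes `q^{|R|-1}`,
  `q^{|R|-2}` for a vector with a coordinate `1` and for a pair with an identity `2 × 2` minor;
* `card_forall_not_mul_le` — **Chebyshev / second moment in counting form**: events of size
  exactly `|Ω|/q` with pairwise intersections exactly `|Ω|/q²` miss at most `|Ω|·q/|S|` points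
  ("these events are pairwise independent. Now apply Chebyshev's inequality", Lemma 5.8);
* `card_not_kill_mul_le` — **Lemma 5.6 (union bound)**: `#{r failing to kill some annoying
  vector} ≤ #A · D · q^{|Rw|-1}`, with `annoyingVectors` the finite set of annoying lattice
  vectors (`#A`);
* `card_no_survivor_mul_le` — **Lemmas 5.7–5.8**: for a family of integer vectors each having a
  coordinate `1` and pairwise identity `2 × 2` minors (the good vectors of Lemma 5.4 for distinct
  index sets `J, J'` of a common size: coordinates `i ∈ J ∖ J'`, `i' ∈ J' ∖ J`),
  `#{r | no member has r·w ≡ 0} · |S| ≤ q^{|Rw|+1}`;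
* `liftRow`, `residues`, `dvd_liftRow_dotProduct_iff` — the dictionary between the integer `r` of
  `finBasis` (entries in `[0,q)`, `liftRow_range`) and the residue vector.

## Faithfulness / rendering

* Printed (pp. 802–803): `q` is a PRIME in `[100#A, #G/100]` (§5.2.1), Lemma 5.6 uses
  "`Pr[r·v ≡ 0] = 1/q` exactly" for `v ≢ 0`, and Lemma 5.8 uses "any two of them are linearly
  independent mod `q`". The statements here hold for an ARBITRARY modulus `q ≥ 1`: the kill
  probability of an annoying vector is `≤ |vᵢ|/q < D/q` for any nonzero coordinate (so the union
  bound needs `q ≥ 100·#A·D` instead of `q > 100·#A`, immaterial in Khot's parameter regime where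
  `#G ≥ 10⁵ #A` has slack `N^{ηd}`), and pairwise independence is derived, pair by pair, from the identity `2 × 2` minor that two
  Lemma-5.4 good vectors with distinct same-size index sets visibly have (`0/1` on the `J`-block,
  at `i ∈ J ∖ J'` and `i' ∈ J' ∖ J`), not from primality. This
  frees the eventual assembly from sampling a prime (a power of two `q` can be used, with exact
  coin sampling). The printed constants `9/10`, `99/100` are obtained downstream by choosing
  `q` and `|S| = #G` accordingly.
* Probabilities are stated as cardinalities of subsets of `(ℤ/q)^{Rw}` multiplied through by the
  denominators (no division).

## References

* S. Khot, *Hardness of approximating the shortest vector problem in lattices*, J. ACM 52 (2005)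
  789–808, §5.2.1–5.2.2, Lemmas 5.6, 5.7, 5.8 (pp. 802–803).
-/

namespace Literature.Algebra.EuclideanLattices.Khot

open Matrix Finset

/-! ### Linear forms `r ↦ r · a` on `(ℤ/q)^R` and the sizes of their fibres -/

section Forms

variable {R : Type} [Fintype R] [DecidableEq R] {q : ℕ} [NeZero q]

/-- The linear form `r ↦ r · a = ∑ᵢ rᵢ aᵢ` on `(ℤ/q)^R`, as an additive homomorphism (Khot 2005,
§5.2.2: "a random homogeneous linear constraint on the co-ordinates"). [cite: Khot2005, §5.2.2] -/
def dotForm (a : R → ZMod q) : (R → ZMod q) →+ ZMod q where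
  toFun r := r ⬝ᵥ a
  map_zero' := zero_dotProduct a
  map_add' r r' := add_dotProduct r r' a

omit [DecidableEq R] [NeZero q] in
/-- `dotForm a r = r ⬝ᵥ a`. [cite: Khot2005, §5.2.2] -/
@[simp] theorem dotForm_apply (a r : R → ZMod q) : dotForm a r = r ⬝ᵥ a := rfl

omit [NeZero q] in
/-- On a basis vector: `dotForm a (n • e_i) = n • a i`. [cite: Khot2005, §5.2.2] -/
theorem dotForm_single (a : R → ZMod q) (i : R) (n : ZMod q) :
    dotForm a (Pi.single i n) = n * a i := by
  simp [dotForm]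

/-- **Fibres of an additive homomorphism to a finite group are either empty or all of the same
size `|G| / |range|`**: for `y` in the range, `#{g | f g = y} · #(range) = |G|`.
(Mathlib `AddMonoidHom.card_fiber_eq_of_mem_range`.) [folklore] -/
theorem card_fiber_mul_card_range {G M : Type*} [AddCommGroup G] [Fintype G] [AddCommGroup M]
    [Fintype M] [DecidableEq M] (f : G →+ M) {y : M} (hy : y ∈ Set.range f) :
    #{g | f g = y} * #(univ.image f) = Fintype.card G := by
  classical
  rw [← Finset.card_univ, Finset.card_eq_sum_card_fiberwise (f := f) (s := univ)
    (t := univ.image f) (fun g _ => mem_image_of_mem f (mem_univ g))]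
  rw [Finset.sum_const_nat (m := #{g | f g = y}) fun y' hy' => ?_, mul_comm]
  obtain ⟨g, -, rfl⟩ := mem_image.1 hy'
  exact AddMonoidHom.card_fiber_eq_of_mem_range f ⟨g, rfl⟩ hy

/-- **Lemma 5.6, counting core.** If some coordinate of `a` is the residue of an integer `v`
with `v ≠ 0 (mod q)`... more precisely `a i₀ = v` for an integer `v` with `0 < |v|`, then the
number of `r ∈ (ℤ/q)^R` with `r · a = 0` is at most `q^{|R|-1} · |v|`: the range of the form
contains the multiples of `a i₀`, of which there are `q / gcd(q, |v|) ≥ q / |v|`. (Printed for a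
prime `q` and `v ≢ 0`: "the probability that `r(B_int x) ≡ 0 (mod q)` is exactly `1/q`"; this is
the version for an arbitrary modulus, probability `≤ |v|/q`.) [cite: Khot2005, Lemma 5.6 (proof)] -/
theorem card_dotForm_eq_zero_mul_le (a : R → ZMod q) {i₀ : R} {v : ℤ} (hv : v ≠ 0)
    (ha : a i₀ = (v : ZMod q)) :
    #{r : R → ZMod q | r ⬝ᵥ a = 0} * q ≤ q ^ Fintype.card R * v.natAbs := by
  classical
  have hfib := card_fiber_mul_card_range (dotForm a) (y := 0) ⟨0, map_zero _⟩
  simp only [dotForm_apply] at hfib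
  rw [Fintype.card_pi, Finset.prod_const, ZMod.card, Finset.card_univ] at hfib
  -- the range contains the cyclic subgroup generated by `a i₀`
  have hsub : (univ.filter fun y : ZMod q => y ∈ AddSubgroup.zmultiples (a i₀)) ⊆
      univ.image (dotForm a) := by
    intro y hy
    obtain ⟨n, rfl⟩ := AddSubgroup.mem_zmultiples_iff.1 (mem_filter.1 hy).2
    refine mem_image.2 ⟨Pi.single i₀ (n : ZMod q), mem_univ _, ?_⟩
    rw [dotForm_single, zsmul_eq_mul]
  have hord : #(univ.filter fun y : ZMod q => y ∈ AddSubgroup.zmultiples (a i₀)) =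
      addOrderOf (a i₀) := by
    rw [← Fintype.card_zmultiples, Fintype.card_subtype]
  -- `addOrderOf (a i₀) * gcd = q`
  have hgcd : addOrderOf (a i₀) * q.gcd v.natAbs = q := by
    have h1 : addOrderOf (a i₀) = addOrderOf ((v.natAbs : ℕ) : ZMod q) := by
      rw [ha]
      rcases Int.natAbs_eq v with h | h
      · conv_lhs => rw [h]
        simp
      · conv_lhs => rw [h]
        rw [Int.cast_neg, addOrderOf_neg]
        simp
    rw [h1, ZMod.addOrderOf_coe' q (Int.natAbs_ne_zero.2 hv)]
    exact Nat.div_mul_cancel (Nat.gcd_dvd_left _ _)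
  have hle : addOrderOf (a i₀) ≤ #(univ.image (dotForm a)) := hord ▸ Finset.card_le_card hsub
  calc #{r : R → ZMod q | r ⬝ᵥ a = 0} * q
      = #{r : R → ZMod q | r ⬝ᵥ a = 0} * addOrderOf (a i₀) * q.gcd v.natAbs := by
        rw [mul_assoc, hgcd]
    _ ≤ #{r : R → ZMod q | r ⬝ᵥ a = 0} * #(univ.image (dotForm a)) * v.natAbs :=
        Nat.mul_le_mul (Nat.mul_le_mul_left _ hle) (Nat.gcd_le_right _ (Int.natAbs_pos.2 hv))
    _ = q ^ Fintype.card R * v.natAbs := by rw [hfib]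

/-- If some coordinate of `a` equals `1`, the form `r ↦ r · a` is onto and every fibre has
exactly `q^{|R|-1}` elements: `#{r | r · a = y} · q = q^{|R|}`. (Khot 2005, Lemma 5.7: the good
vectors "have `{0,1,2}` co-ordinates with at least one co-ordinate equal to `1`".)
[cite: Khot2005, Lemma 5.7 (proof)] -/
theorem card_dotForm_eq_mul_of_one (a : R → ZMod q) {i₀ : R} (ha : a i₀ = 1) (y : ZMod q) :
    #{r : R → ZMod q | r ⬝ᵥ a = y} * q = q ^ Fintype.card R := by
  classical
  have hsurj : Function.Surjective (dotForm a) := fun z =>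
    ⟨Pi.single i₀ z, by rw [dotForm_single, ha, mul_one]⟩
  have hfib := card_fiber_mul_card_range (dotForm a) (y := y) (hsurj y)
  have hrange : univ.image (dotForm a) = univ :=
    eq_univ_of_forall fun z => mem_image.2 ⟨(hsurj z).choose, mem_univ _, (hsurj z).choose_spec⟩
  rw [hrange, Finset.card_univ, ZMod.card, Fintype.card_pi, Finset.prod_const, ZMod.card,
    Finset.card_univ] at hfib
  simpa only [dotForm_apply] using hfib

/-- **Pairwise independence from an identity minor** (Khot 2005, Lemma 5.8 with Lemma 5.7: any
two good vectors "are linearly independent mod `q`"; here in the concrete form available for the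
good vectors of Lemma 5.4, which needs no primality of `q`): if `a i = 1, a' i = 0` and
`a i' = 0, a' i' = 1` for two coordinates `i, i'` (necessarily distinct), then the pair of forms
is onto `(ℤ/q)²` and
`#{r | r · a = y ∧ r · a' = y'} · q² = q^{|R|}`. [cite: Khot2005, Lemma 5.8] -/
theorem card_dotForm_pair_eq_mul (a a' : R → ZMod q) {i i' : R} (hai : a i = 1)
    (ha'i : a' i = 0) (hai' : a i' = 0) (ha'i' : a' i' = 1) (y y' : ZMod q) :
    #{r : R → ZMod q | r ⬝ᵥ a = y ∧ r ⬝ᵥ a' = y'} * q ^ 2 = q ^ Fintype.card R := by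
  classical
  let f : (R → ZMod q) →+ ZMod q × ZMod q := (dotForm a).prod (dotForm a')
  have hsurj : Function.Surjective f := fun z => by
    refine ⟨Pi.single i z.1 + Pi.single i' z.2, ?_⟩
    ext <;> simp [f, hai, ha'i, hai', ha'i']
  have hfib := card_fiber_mul_card_range f (y := (y, y')) (hsurj _)
  have hrange : univ.image f = univ :=
    eq_univ_of_forall fun z => mem_image.2 ⟨(hsurj z).choose, mem_univ _, (hsurj z).choose_spec⟩
  rw [hrange, Finset.card_univ, Fintype.card_prod, ZMod.card, Fintype.card_pi, Finset.prod_const,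
    ZMod.card, Finset.card_univ, ← pow_two] at hfib
  convert hfib using 3
  ext r
  simp [f, Prod.ext_iff]

end Forms

/-! ### Chebyshev for a pairwise-independent family of events (Lemma 5.8) -/

section Chebyshev

variable {Ω κ : Type} [Fintype Ω] [DecidableEq κ]

/-- **Second-moment (Chebyshev) bound in counting form** (Khot 2005, Lemma 5.8: "for any fixed
vector `v ∈ S`, the probability that `r · v ≡ 0 (mod q)` is exactly `1/q` and these events are
pairwise independent. Now apply Chebyshev's inequality": `Pr[no event] ≤ q/|S|`). Abstractly:
events `E_J ⊆ Ω`, `J ∈ S`, each of size exactly `|Ω|/q` and pairwise intersections of size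
exactly `|Ω|/q²`; then the number of sample points in no event is at most `|Ω| · q / |S|`, i.e.
`#{ω | ∀ J ∈ S, ω ∉ E_J} · |S| ≤ |Ω| · q`. [cite: Khot2005, Lemma 5.8] -/
theorem card_forall_not_mul_le (S : Finset κ) (E : κ → Ω → Prop) [∀ J, DecidablePred (E J)]
    (q : ℕ) (h1 : ∀ J ∈ S, #{ω | E J ω} * q = Fintype.card Ω)
    (h2 : ∀ J ∈ S, ∀ J' ∈ S, J ≠ J' → #{ω | E J ω ∧ E J' ω} * q ^ 2 = Fintype.card Ω) :
    #{ω | ∀ J ∈ S, ¬E J ω} * S.card ≤ Fintype.card Ω * q := by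
  classical
  set n : ℕ := S.card with hn
  rcases Nat.eq_zero_or_pos n with hn0 | hnpos
  · rw [hn0, mul_zero]; exact Nat.zero_le _
  set M : ℕ := Fintype.card Ω with hM
  -- the counting random variable `X ω = #{J ∈ S | E J ω}` as an integer
  let X : Ω → ℤ := fun ω => ∑ J ∈ S, if E J ω then 1 else 0
  have hXcard : ∀ ω, X ω = ((S.filter fun J => E J ω).card : ℤ) := fun ω => by
    simp only [X, Finset.card_filter, Nat.cast_sum, Nat.cast_ite, Nat.cast_one, Nat.cast_zero]
  -- first moment
  have hA : (∑ ω, X ω) * q = n * M := by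
    have hswap : ∑ ω, X ω = ∑ J ∈ S, (#{ω | E J ω} : ℤ) := by
      simp only [X]
      rw [Finset.sum_comm]
      refine Finset.sum_congr rfl fun J _ => ?_
      rw [Finset.card_filter, Nat.cast_sum]
      simp
    rw [hswap, Finset.sum_mul]
    calc ∑ J ∈ S, (#{ω | E J ω} : ℤ) * q = ∑ _J ∈ S, (M : ℤ) :=
          Finset.sum_congr rfl fun J hJ => by exact_mod_cast h1 J hJ
      _ = n * M := by rw [Finset.sum_const, nsmul_eq_mul]
  -- second moment
  have hB : (∑ ω, X ω ^ 2) * q ^ 2 = n * M * q + n * (n - 1) * M := by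
    have hsq : ∀ ω, X ω ^ 2 = ∑ J ∈ S, ∑ J' ∈ S, if E J ω ∧ E J' ω then 1 else 0 := fun ω => by
      simp only [X, sq, Finset.sum_mul_sum]
      refine Finset.sum_congr rfl fun J _ => Finset.sum_congr rfl fun J' _ => ?_
      split_ifs <;> simp_all
    have hswap : ∑ ω, X ω ^ 2 = ∑ J ∈ S, ∑ J' ∈ S, (#{ω | E J ω ∧ E J' ω} : ℤ) := by
      simp only [hsq]
      rw [Finset.sum_comm]
      refine Finset.sum_congr rfl fun J _ => ?_
      rw [Finset.sum_comm]
      refine Finset.sum_congr rfl fun J' _ => ?_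
      rw [Finset.card_filter, Nat.cast_sum]
      simp
    rw [hswap, Finset.sum_mul]
    have hinner : ∀ J ∈ S, (∑ J' ∈ S, (#{ω | E J ω ∧ E J' ω} : ℤ)) * q ^ 2 = M * q + (n - 1) * M := by
      intro J hJ
      rw [← Finset.add_sum_erase S _ hJ, add_mul, Finset.sum_mul]
      have hdiag : (#{ω | E J ω ∧ E J ω} : ℤ) * q ^ 2 = M * q := by
        have : (univ.filter fun ω => E J ω ∧ E J ω) = univ.filter fun ω => E J ω := by
          ext ω; simp
        rw [this, pow_two, ← mul_assoc]
        exact_mod_cast congrArg (· * q) (h1 J hJ)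
      have hoff : ∑ J' ∈ S.erase J, (#{ω | E J ω ∧ E J' ω} : ℤ) * q ^ 2 = (n - 1) * M := by
        calc ∑ J' ∈ S.erase J, (#{ω | E J ω ∧ E J' ω} : ℤ) * q ^ 2 = ∑ _J' ∈ S.erase J, (M : ℤ) :=
              Finset.sum_congr rfl fun J' hJ' => by
                exact_mod_cast h2 J hJ J' (Finset.mem_of_mem_erase hJ') (Finset.ne_of_mem_erase hJ').symm
          _ = (n - 1) * M := by
              rw [Finset.sum_const, nsmul_eq_mul, Finset.card_erase_of_mem hJ]
              push_cast [Nat.one_le_iff_ne_zero.2 (by omega : S.card ≠ 0)]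
              ring
      rw [hdiag, hoff]
    calc ∑ J ∈ S, (∑ J' ∈ S, (#{ω | E J ω ∧ E J' ω} : ℤ)) * q ^ 2 = ∑ _J ∈ S, ((M : ℤ) * q + (n - 1) * M) :=
          Finset.sum_congr rfl hinner
      _ = n * M * q + n * (n - 1) * M := by rw [Finset.sum_const, nsmul_eq_mul]; ring
  -- the sum of squares `∑ (qX - n)²`
  have hdev : ∑ ω, ((q : ℤ) * X ω - n) ^ 2 = n * M * q - n * M := by
    have hexp : ∑ ω, ((q : ℤ) * X ω - n) ^ 2 =
        (q : ℤ) ^ 2 * (∑ ω, X ω ^ 2) - 2 * n * q * (∑ ω, X ω) + M * n ^ 2 := by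
      calc ∑ ω, ((q : ℤ) * X ω - n) ^ 2
          = ∑ ω, ((q : ℤ) ^ 2 * X ω ^ 2 - 2 * n * q * X ω + (n : ℤ) ^ 2) :=
            Finset.sum_congr rfl fun ω _ => by ring
        _ = (q : ℤ) ^ 2 * (∑ ω, X ω ^ 2) - 2 * n * q * (∑ ω, X ω) + M * n ^ 2 := by
            rw [Finset.sum_add_distrib, Finset.sum_sub_distrib, ← Finset.mul_sum, ← Finset.mul_sum,
              Finset.sum_const, Finset.card_univ, nsmul_eq_mul, hM]
    rw [hexp]
    linear_combination hB - 2 * (n : ℤ) * hA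
  -- points in no event contribute `n²` each
  have hlow : (#{ω | ∀ J ∈ S, ¬E J ω} : ℤ) * n ^ 2 ≤ ∑ ω, ((q : ℤ) * X ω - n) ^ 2 := by
    have hzero : ∀ ω ∈ univ.filter (fun ω => ∀ J ∈ S, ¬E J ω), ((q : ℤ) * X ω - n) ^ 2 = n ^ 2 := by
      intro ω hω
      have hX0 : X ω = 0 := by
        simp only [X]
        exact Finset.sum_eq_zero fun J hJ => if_neg ((mem_filter.1 hω).2 J hJ)
      rw [hX0, mul_zero, zero_sub, neg_sq]
    calc (#{ω | ∀ J ∈ S, ¬E J ω} : ℤ) * n ^ 2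
        = ∑ ω ∈ univ.filter (fun ω => ∀ J ∈ S, ¬E J ω), ((q : ℤ) * X ω - n) ^ 2 := by
          rw [Finset.sum_congr rfl hzero, Finset.sum_const, nsmul_eq_mul]
      _ ≤ ∑ ω, ((q : ℤ) * X ω - n) ^ 2 :=
          Finset.sum_le_sum_of_subset_of_nonneg (filter_subset _ _) fun ω _ _ => sq_nonneg _
  -- conclude: `N₀ n² ≤ nMq - nM ≤ nMq`, divide by `n > 0`
  have hfin : (#{ω | ∀ J ∈ S, ¬E J ω} : ℤ) * n ^ 2 ≤ n * M * q := by
    have hMn : (0 : ℤ) ≤ n * M := by positivity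
    linarith [hlow, hdev]
  have hn' : (0 : ℤ) < n := by exact_mod_cast hnpos
  have : (#{ω | ∀ J ∈ S, ¬E J ω} : ℤ) * n ≤ M * q := by
    have h := hfin
    rw [pow_two, ← mul_assoc] at h
    rw [show (n : ℤ) * M * q = (M * q) * n by ring] at h
    exact le_of_mul_le_mul_right h hn'
  exact_mod_cast this

end Chebyshev

/-! ### The two probabilistic lemmas of §5.2.2 in counting form -/

section Sublattice

variable {Rw C : Type} [Fintype Rw] [Fintype C] [DecidableEq Rw] {q : ℕ} [NeZero q]

/-- The residues modulo `q` of an integer vector. [folklore] -/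
def residues (q : ℕ) (v : Rw → ℤ) : Rw → ZMod q := fun i => (v i : ZMod q)

/-- The integer row vector with entries in `[0, q)` lifting `r ∈ (ℤ/q)^{Rw}` (the `r` of
`Khot.finBasis`). [cite: Khot2005, §5.2.2] -/
def liftRow (r : Rw → ZMod q) : Rw → ℤ := fun i => ((r i).val : ℤ)

omit [Fintype Rw] [DecidableEq Rw] in
/-- The entries of `liftRow r` lie in `[0, q)` (as required by `Khot.yes_finBasis`).
[cite: Khot2005, §5.2.2] -/
theorem liftRow_range (r : Rw → ZMod q) (i : Rw) : 0 ≤ liftRow r i ∧ liftRow r i < q :=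
  ⟨Int.natCast_nonneg _, by
    show ((r i).val : ℤ) < q
    exact_mod_cast ZMod.val_lt (r i)⟩

omit [DecidableEq Rw] in
/-- Divisibility of the integer pairing is vanishing of the pairing of residues:
`q ∣ (liftRow r) · v ↔ r · (v mod q) = 0`. [folklore] -/
theorem dvd_liftRow_dotProduct_iff (r : Rw → ZMod q) (v : Rw → ℤ) :
    (q : ℤ) ∣ liftRow r ⬝ᵥ v ↔ r ⬝ᵥ residues q v = 0 := by
  rw [← ZMod.intCast_zmod_eq_zero_iff_dvd]
  simp only [dotProduct, liftRow, residues, Int.cast_sum, Int.cast_mul, Int.cast_natCast,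
    ZMod.natCast_zmod_val]

/-- The finite set of ANNOYING LATTICE VECTORS of `L(B)` (Khot 2005, Def. 5.3): vectors `Bx` that
are annoying for the parameters `d, D`; finite because all their coordinates lie in `(-D, D)`.
[cite: Khot2005, Def. 5.3] -/
noncomputable def annoyingVectors (B : Matrix Rw C ℤ) (d D : ℕ) : Finset (Rw → ℤ) := by
  classical
  exact (Fintype.piFinset fun _ : Rw => Finset.Ioo (-(D : ℤ)) D).filter
    fun v => (∃ x, B *ᵥ x = v) ∧ Annoying v d D

/-- Membership in `annoyingVectors`. [cite: Khot2005, Def. 5.3] -/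
theorem mem_annoyingVectors {B : Matrix Rw C ℤ} {d D : ℕ} {v : Rw → ℤ} :
    v ∈ annoyingVectors B d D ↔ (∃ x, B *ᵥ x = v) ∧ Annoying v d D := by
  classical
  unfold annoyingVectors
  simp only [Finset.mem_filter, Fintype.mem_piFinset, Finset.mem_Ioo, and_iff_right_iff_imp]
  rintro ⟨-, -, hsmall, -⟩ i
  exact abs_lt.1 (hsmall i)

/-- **Lemma 5.6 in counting form (union bound).** The number of row vectors `r ∈ (ℤ/q)^{Rw}`
that FAIL to kill some annoying lattice vector — `r · (Bx) ≡ 0 (mod q)` for an annoying `Bx` —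
is at most `#A · D · q^{|Rw| - 1}` (`#A` = the number of annoying lattice vectors): each annoying
vector has a nonzero coordinate of magnitude `< D`, so is killed by all but a fraction `< D/q` of
the `r` (`card_dotForm_eq_zero_mul_le`). Printed (prime `q > 100·#A`): "with probability
`99/100`, Eq. (1) fails for every annoying vector". The complement event is exactly the
hypothesis `hkill` of `Khot.noStructure_finBasis` (via `dvd_liftRow_dotProduct_iff`).
[cite: Khot2005, Lemma 5.6] -/
theorem card_not_kill_mul_le (B : Matrix Rw C ℤ) (d D : ℕ)
    [DecidablePred fun r : Rw → ZMod q => ∃ x, Annoying (B *ᵥ x) d D ∧ r ⬝ᵥ residues q (B *ᵥ x) = 0] :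
    #{r : Rw → ZMod q | ∃ x, Annoying (B *ᵥ x) d D ∧ r ⬝ᵥ residues q (B *ᵥ x) = 0} * q ≤
      (annoyingVectors B d D).card * (q ^ Fintype.card Rw * D) := by
  classical
  -- the bad set is covered by the kernels of the forms of the annoying vectors
  have hcover : (univ.filter fun r : Rw → ZMod q =>
      ∃ x, Annoying (B *ᵥ x) d D ∧ r ⬝ᵥ residues q (B *ᵥ x) = 0) ⊆
      (annoyingVectors B d D).biUnion fun v => univ.filter fun r : Rw → ZMod q =>
        r ⬝ᵥ residues q v = 0 := by
    intro r hr
    obtain ⟨x, hA, h0⟩ := (mem_filter.1 hr).2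
    exact mem_biUnion.2 ⟨B *ᵥ x, mem_annoyingVectors.2 ⟨⟨x, rfl⟩, hA⟩, mem_filter.2 ⟨mem_univ _, h0⟩⟩
  refine le_trans (Nat.mul_le_mul_right q ((card_le_card hcover).trans card_biUnion_le)) ?_
  rw [Finset.sum_mul, Finset.card_eq_sum_ones (annoyingVectors B d D), Finset.sum_mul]
  refine Finset.sum_le_sum fun v hv => ?_
  obtain ⟨hne, hsmall, -, -⟩ := (mem_annoyingVectors.1 hv).2
  obtain ⟨i₀, hi₀⟩ := Function.ne_iff.1 hne
  calc #{r : Rw → ZMod q | r ⬝ᵥ residues q v = 0} * q ≤ q ^ Fintype.card Rw * (v i₀).natAbs :=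
        card_dotForm_eq_zero_mul_le (residues q v) hi₀ rfl
    _ ≤ 1 * (q ^ Fintype.card Rw * D) := by
        rw [one_mul]
        refine Nat.mul_le_mul_left _ ?_
        have := hsmall i₀
        have h2 : ((v i₀).natAbs : ℤ) < D := by rw [Int.natCast_natAbs]; exact this
        exact_mod_cast h2.le

/-- **Lemmas 5.7–5.8 in counting form.** For a family of integer vectors `w_J`, `J ∈ S`, such
that every `w_J` has SOME coordinate equal to `1` and every PAIR `J ≠ J'` has an identity `2 × 2`
minor — coordinates `i, i'` (depending on the pair) with `w_J i = 1, w_J' i = 0, w_J i' = 0,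
w_J' i' = 1`; the good vectors `2(B_cvp ỹ - t) ∘ (0 ∘ 1_J)` of Lemma 5.4 for distinct `J` of a
common size have this with `i ∈ J ∖ J'`, `i' ∈ J' ∖ J` — the number of `r ∈ (ℤ/q)^{Rw}` for
which NO `w_J` satisfies `r · w_J ≡ 0 (mod q)` obeys `#{r | ∀ J ∈ S, r·w_J ≢ 0} · |S| ≤
q^{|Rw|} · q` ("with probability `99/100`, there exists a good vector `B_int x*` such that
`r(B_int x*) ≡ 0 (mod q)`" when `|S| ≥ 100q`). Printed via "any two of them are linearly
independent mod `q`" for a prime `q` (Lemma 5.8); the identity minor gives the same pairwise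
independence for every modulus. [cite: Khot2005, Lemma 5.7 and Lemma 5.8] -/
theorem card_no_survivor_mul_le {κ : Type} [DecidableEq κ] (S : Finset κ) (w : κ → Rw → ℤ)
    (hone : ∀ J ∈ S, ∃ i, w J i = 1)
    (hpair : ∀ J ∈ S, ∀ J' ∈ S, J ≠ J' →
      ∃ i i', w J i = 1 ∧ w J' i = 0 ∧ w J i' = 0 ∧ w J' i' = 1) :
    #{r : Rw → ZMod q | ∀ J ∈ S, r ⬝ᵥ residues q (w J) ≠ 0} * S.card ≤
      q ^ Fintype.card Rw * q := by
  classical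
  have hcard : Fintype.card (Rw → ZMod q) = q ^ Fintype.card Rw := by
    rw [Fintype.card_pi, Finset.prod_const, ZMod.card, Finset.card_univ]
  have h := card_forall_not_mul_le (Ω := Rw → ZMod q) S (fun J r => r ⬝ᵥ residues q (w J) = 0) q
    (fun J hJ => by
      obtain ⟨i, hi⟩ := hone J hJ
      rw [hcard]
      exact card_dotForm_eq_mul_of_one (residues q (w J)) (i₀ := i) (by simp [residues, hi]) 0)
    (fun J hJ J' hJ' hJJ' => by
      obtain ⟨i, i', h1, h2, h3, h4⟩ := hpair J hJ J' hJ' hJJ'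
      rw [hcard]
      exact card_dotForm_pair_eq_mul (residues q (w J)) (residues q (w J')) (i := i) (i' := i')
        (by simp [residues, h1]) (by simp [residues, h2]) (by simp [residues, h3])
        (by simp [residues, h4]) 0 0)
  rwa [hcard] at h

end Sublattice

end Literature.Algebra.EuclideanLattices.Khot
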